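import Summits.Ventures.CertifiedManyBodySolver.Observables.PolarisedClassExclusionLaU10
import HarnessLib

/-!
# Ventures/CertifiedManyBodySolver — Observables/PolarisedClassExclusionLaV2.lean

HONEST FRAMING: first certified bounds; not a superconductivity verdict; every number certified or labelled float.
A competing-order EXCLUSION removes a named class of candidate ground states; it never says which order is present;
no phase sentence follows.

Cell `hubbard-tc` (MO-S3, D-0096), seat `hubbard-tc-mod-3` (G3), `prover-hubbard-tc-mod-3-g4-0`. SATURATED-FERROMAGNET words for the two
VSET-v2 child columns of the La₂₋ₓSrₓCuO₄ box of record (object E `U/t_eff ∈ [5.9, 14.7]`, `t′/t_eff ∈ [−0.30, −0.20]`; S1 §OF-RECORD v1.9/v1.10):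

* `laE_x003_lt_polarised_of` — x = 0.03 (M54, `n ∈ [0.95, 0.99]`): `e(1, t′, U, n) < ½·e(1, t′, 0, 2n)` for EVERY `0 ≤ U ≤ 16` (WHOLE box; cond. #469;
  vacuum chord of the `U = 16` half-filling cap, exactly as `laE_x0_lt_polarised_of`; margin `+0.025`);
* `laE_x005_lt_polarised_U10_of` — x = 0.05 (M53, `n ∈ [0.93, 0.97]`): EVERY `0 ≤ U ≤ 10` (covers `[5.9, 10]`; cond. #445 ∧ #257 (both edges) ∧ #471;
  the McCormick high-band chords of `PolarisedClassExclusionLaU10.lean` on the docc-tangent `7/8` anchor at `U = 10` and the #471 half-filling cap,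
  exactly as `laE_x007_lt_polarised_U10_of`; margins `+0.10` / `+0.11`; at `U₂ = 12` the test fails, `−0.03`).

The one-species bathtub floor `½·e(1, t′, 0, 2n)` of every fully polarised state lies strictly above a certified GS-energy cap ⇒ the ground state is not
saturated-FM (Tasaki 1998 Thm 6.1 logic). Floors = tangent rows at `2n₀ = 93/50` (`HubbardFermiSeaTangentRowsHigh`). Exact designer:
`hubbard-tc-mod-3/g4-replay/fm_design.py` (M53/M54 block).
WHAT THIS IS NOT: a statement about unsaturated ferromagnetism, stripes, d-wave order or T_c; tight; a phase word.

References: E. H. Lieb, M. Loss, Duke Math. J. 71 (1993) 337, §8 Thm 8.2 [LiebLoss1993]; H. Tasaki, J. Phys.: Condens. Matter 10 (1998)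
4353, §2 Def. 2.1, §6 Thm. 6.1 [Tasaki1998]; T. Koma, H. Tasaki, J. Stat. Phys. 76 (1994) 745, §1 [KomaTasaki1994]; R. B. Israel,
Convexity in the Theory of Lattice Gases (1979), Thm I.3.4 [Israel1979]; D. Ruelle, Statistical Mechanics (1969) §3.3 [Ruelle1969].
-/

noncomputable section

namespace Summit.Ventures.CertifiedManyBodySolver.Observables

open Literature.MathematicalPhysics.QuantumLattice
open Literature.MathematicalPhysics.QuantumLattice.ThermodynamicLimit
open Summit.Ventures.CertifiedManyBodySolver.Certificates
open Matrix HubbardWave0 Literature.Probability.LatticeModels Filter Topology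
open scoped ComplexOrder BigOperators

/-- **La₁.₉₇Sr₀.₀₃CuO₄ (VSET-v2 M54), OBJECT E `n ∈ [0.95, 0.99]`, `t′ ∈ [−3/10, −1/5]`: the SATURATED-FM class is excluded on the WHOLE box** —
for every `0 ≤ U ≤ 16` (box `U/t_eff ∈ [5.9, 14.7]`), `e(1, t′, U, n) < ½·e(1, t′, 0, 2n)`. Cap = vacuum chord of the CERTIFIED #469 half-filling cap at
`U = 16` (`t′`-even + concave; monotone in `U`), floor = tangent rows at `2n₀ = 93/50`; smallest margin `+0.025` (at `n = 0.95`, `t′ = −3/10`).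
[cite: LiebLoss1993, §8, Theorem 8.2] [cite: Tasaki1998, §2 Def. 2.1, §6 Thm. 6.1] [cite: Israel1979, Thm. I.3.4] -/
theorem laE_x003_lt_polarised_of (h469 : cert_r469_pb2_tl_upper_n1_U16)
    {t' U n : ℝ} (ht1 : -3 / 10 ≤ t') (ht2 : t' ≤ -1 / 5) (hU0 : 0 ≤ U) (hU : U ≤ 16)
    (hn1 : 19 / 20 ≤ n) (hn2 : n ≤ 99 / 100) :
    energyDensityTT' 1 t' U n < 1 / 2 * energyDensityTT' 1 t' 0 (2 * n) := by
  have hn0 : (0 : ℝ) ≤ n := by linarith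
  have hn2' : n < 2 := by linarith
  have hnpos : (0 : ℝ) < n := by linarith
  have h2n0 : (0 : ℝ) ≤ 2 * n := by linarith
  have h2n2 : 2 * n < 2 := by linarith
  have hC16 := polar_halfFilling_cap16 h469 t'
  have hcap := polar_half_cap16 hC16 hnpos (by linarith)
  have ra := fermiSeaTangentRow_tPrime_neg_three_div_ten_at_ninetythree_div_fifty (U := 0) le_rfl h2n0 h2n2
  have rb := fermiSeaTangentRow_tPrime_neg_one_div_four_at_ninetythree_div_fifty (U := 0) le_rfl h2n0 h2n2
  have rc := fermiSeaTangentRow_tPrime_neg_one_div_five_at_ninetythree_div_fifty (U := 0) le_rfl h2n0 h2n2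
  rcases le_or_gt t' (-1 / 4) with hp | hp
  · -- piece `t' ∈ [-3 / 10, -1 / 4]`
    have hfl := objE_floor_between (s := t') h2n0 h2n2 (by norm_num : (-3 / 10 : ℝ) ≤ -1 / 4) ra rb (by linarith) (by linarith)
    exact polar_word_of_cap hU0 hU hn0 hn2' hcap hfl (by linarith) (by linarith)
  · -- `t' > -1 / 4`
    have hfl := objE_floor_between (s := t') h2n0 h2n2 (by norm_num : (-1 / 4 : ℝ) ≤ -1 / 5) rb rc (by linarith) (by linarith)
    exact polar_word_of_cap hU0 hU hn0 hn2' hcap hfl (by linarith) (by linarith)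

/-- **La₁.₉₅Sr₀.₀₅CuO₄ (VSET-v2 M53), OBJECT E `n ∈ [0.93, 0.97]`, `t′ ∈ [−3/10, −1/5]`: the SATURATED-FM class is excluded for EVERY
`0 ≤ U ≤ 10`** (box `U/t_eff ∈ [5.9, 14.7]` ⇒ covers `[5.9, 10]`; at `U₂ = 12` the test fails, `−0.03`). Assume the claim nodes of CERTIFIED #445,
#257 (both edges) and #471. Cap at `U₂ = 10` = the McCormick high-band chords `polarU_highBand_deep` (`t′ ≤ −1/4`) /
`polarU_highBand_shallow` (`t′ ≥ −1/4`) on `polarU_cap78_tpm1o4_U10` ∧ `polarU_halfFilling_cap10`, monotone in `U` below `10`; floor = tangent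
rows at `2n₀ = 93/50` on the columns `−3/10, −1/4, −1/5`; smallest linear margins `+0.10` / `+0.11`.
[cite: LiebLoss1993, §8, Theorem 8.2] [cite: Tasaki1998, §2 Def. 2.1, §6 Thm. 6.1] [cite: Israel1979, Thm. I.3.4] -/
theorem laE_x005_lt_polarised_U10_of (h445 : cert_dbt329pair_allk)
    (h257lo : cert_r257_lro_M3U8tpm1o4_w2_b4_kry1_kry2c3_hop2_Dlo)
    (h257up : cert_r257_lro_M3U8tpm1o4_w2_b4_kry1_kry2c3_hop2_Dup) (h471 : cert_r471_pb2_tl_upper_n1_U10)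
    {t' U n : ℝ} (ht1 : -3 / 10 ≤ t') (ht2 : t' ≤ -1 / 5) (hU0 : 0 ≤ U) (hU : U ≤ 10)
    (hn1 : 93 / 100 ≤ n) (hn2 : n ≤ 97 / 100) :
    energyDensityTT' 1 t' U n < 1 / 2 * energyDensityTT' 1 t' 0 (2 * n) := by
  have hn0 : (0 : ℝ) ≤ n := by linarith
  have hn2' : n < 2 := by linarith
  have h2n0 : (0 : ℝ) ≤ 2 * n := by linarith
  have h2n2 : 2 * n < 2 := by linarith
  have h10 : (0 : ℝ) ≤ 10 := by norm_num
  have hM := polarU_cap78_tpm1o4_U10 h445 h257lo h257up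
  have hC := polarU_halfFilling_cap10 h471 t'
  have ra := fermiSeaTangentRow_tPrime_neg_three_div_ten_at_ninetythree_div_fifty (U := 0) le_rfl h2n0 h2n2
  have rb := fermiSeaTangentRow_tPrime_neg_one_div_four_at_ninetythree_div_fifty (U := 0) le_rfl h2n0 h2n2
  have rc := fermiSeaTangentRow_tPrime_neg_one_div_five_at_ninetythree_div_fifty (U := 0) le_rfl h2n0 h2n2
  rcases le_or_gt t' (-1 / 4) with hp | hp
  · -- piece `t' ∈ [-3/10, -1/4]`: far side of the anchor
    have hcap := polarU_highBand_deep (n := n) h10 hM hC (b := -1 / 4) le_rfl hp hn1 (by linarith) (by linarith)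
    have hfl := objE_floor_between (s := t') h2n0 h2n2 (by norm_num : (-3 / 10 : ℝ) ≤ -1 / 4) ra rb (by linarith) (by linarith)
    exact polar_word_of_cap hU0 hU hn0 hn2' hcap hfl (by linarith) (by linarith)
  · -- piece `t' ∈ (-1/4, -1/5]`: near side of the anchor
    have hcap := polarU_highBand_shallow (n := n) h10 hM hC (a := -1 / 4) le_rfl hp.le hn1 (by linarith) (by linarith)
    have hfl := objE_floor_between (s := t') h2n0 h2n2 (by norm_num : (-1 / 4 : ℝ) ≤ -1 / 5) rb rc (by linarith) (by linarith)
    exact polar_word_of_cap hU0 hU hn0 hn2' hcap hfl (by linarith) (by linarith)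

end Summit.Ventures.CertifiedManyBodySolver.Observables

end
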